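import Mathlib.Tactic.Linarith
import Summits.CriticalPhenomena.PercolationContinuityZ3.Theorems.PercNearOneGluingNoHeavyLowerTailSahiCTCNcSplitOneSided
import HarnessLib

/-!
# `NoHeavyLowerTail` (crux stmt-CriticalPhenomena-4575), P3 lane: PEELING THE COMMON TOP FACES of the generic certificate polynomial —
# `Ñ_c(K_X,K_Z) = Ñ_c(K_X ∖ e_Y, K_Z) + GF(e_Y)·B_c(K_Z)` and the value-level consequence "`K_X` without faces above `c` and `K_Z` LIGHT
# (`B_c(K_Z)(r) ≥ 0`) ⇒ `Ñ_c(K_X,K_Z)(r) ≥ 0`", with a parameter-only corollary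

Support file (seat `prim-l12-p3`, gen 24; `--supports stmt-CriticalPhenomena-4575`).  Memo
`run/shared/lean/prim/prim-l12/FROM-prim-l12-p3-g24-VALUE-LEVEL-TH2K.md`.  Companions: `…SahiCTCNcGen` (`Ñ_c = Ngen c`),
`…SahiCTCNcSplit` (`Ñ_c = Π·T_c + e_c·R_c`, `T_c ≥ 0` when `e_Y = ∅`), `…SahiCTCNcSplitOneSided` (`R_c ≥ 0` when `t_X = ∅`),
`…SahiAllButC` / `…SahiAtLeastTwoRowA` (the endpoint consumes only the VALUE `Ñ_c(K_𝒳,K_𝒵)(r) ≥ 0` at the odds vector).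

With the level-`c` dictionary (`h_K`, `t_K`, `h_Y`, `e_Y` = common `c`-faces, `Θ_c`, `D_c`, `e_c`, `Π`) put
  `B_c(K_Z) := e_c·(Π + D_c)·(Π − h_Z) − Θ_c·Π·D_c − e_c·D_c·t_Z`     (`peelB`, depends on `K_Z` only).
THIS FILE proves the polynomial identity (every `c`, every pair of families)
  `Ñ_c(K_X, K_Z) = Ñ_c(K_X ∖ e_Y, K_Z) + GF(e_Y)·B_c(K_Z)`             (`Ngen_eq_peel`)
— removing from `K_X` all the common `c`-faces changes `Ñ_c` by `GF(e_Y)` times a bracket that does not see `K_X` — and draws the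
VALUE-LEVEL consequences (the form the endpoint needs):
* `coeff_Ngen_peel_nonneg` : if `K_X` is a complex with no face of size `> c` (`t_X = ∅`) then `K_X ∖ e_Y` is again a complex, shares no
  `c`-face with `K_Z`, and `Ñ_c(K_X ∖ e_Y, K_Z) ∈ ℕ[r]` (level split: `T_c = e_c·Harris`, `R_c = D_c·Harris`);
* **`eval_Ngen_nonneg_of_peelB`** : `t_X = ∅` and `B_c(K_Z)(r) ≥ 0` at some `r ≥ 0` ⇒ `Ñ_c(K_X,K_Z)(r) ≥ 0` (and the mirror image);
* **`eval_Ngen_nonneg_of_rowCap`** : `t_X = t_Z = ∅` and `(e_c·(Π + D_c) − Θ_c·Π)(r) ≥ 0` ⇒ `Ñ_c(K_X,K_Z)(r) ≥ 0` — a condition on the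
  parameter vector alone.
Complement-dual reading for the slot "at least two of `k` open" (`c = k − 2`; `𝒳, 𝒵` the up-sets of open sets, `θ = P(≤ 1 open)`,
`ε = P(exactly 2 open)`, `Z₂ = P(𝒵, ≥ 2 open)`, `Z₁ = P(𝒵, ≤ 1 open)`): `t_X = ∅` says `𝒳` has no singleton member, `B(r) ≥ 0` says
`ε(1+θ)(1 − Z₂) − εθ·Z₁ ≥ θ(1−θ)` ("`𝒵` is light"), and the parameter-only condition is `P(N=2)·(1 + P(N≤1)) ≥ P(N≥2)` for the number `N`
of open block coordinates.  So the (TC) row of `ρ_{k−2}` holds at every pair with one loop-free and one light side, and at EVERY pair of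
loop-free up-sets whenever `P(N=2)(1+P(N≤1)) ≥ P(N≥2)` (memo §2: the remaining case is "both sides heavy", where peeling a common edge
RAISES `Ñ`).  Nothing is asserted about the crux; no unconditional positivity of `Ñ_c` is claimed here.
-/

namespace Summit.CriticalPhenomena.PercolationContinuityZ3.Theorems.SahiCTCForms

open Finset MvPolynomial SahiCTCGenFun

variable {α : Type*} [DecidableEq α] [Fintype α]

/-! ### The bracket and the peeled complex -/

/-- **The peeling bracket `B_c(K_Z) := e_c·(Π + D_c)·(Π − h_Z) − Θ_c·Π·D_c − e_c·D_c·t_Z`** (memo g24 §2). [this work] -/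
noncomputable def peelB (c : ℕ) (KZ : Finset (Finset α)) : MvPolynomial α ℤ :=
  ee c * (PiP + DdC c) * (PiP - gf (facesLE c KZ)) - ThC c * PiP * DdC c - ee c * DdC c * gf (facesGT c KZ)

/-- **The peeled family `K_X ∖ e_Y`**: `K_X` without the common `c`-faces. [this work] -/
def peelX (c : ℕ) (KX KZ : Finset (Finset α)) : Finset (Finset α) := KX \ commonEQ c KX KZ

/-- `e_Y ⊆ h_X`. [this work] -/
theorem commonEQ_subset_facesLE (c : ℕ) (KX KZ : Finset (Finset α)) : commonEQ c KX KZ ⊆ facesLE c KX := by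
  intro S hS
  simp only [commonEQ, facesLE, mem_filter, mem_powerset, subset_univ, true_and] at hS ⊢
  exact ⟨hS.1.le, hS.2.1⟩

/-- `e_Y ⊆ h_Y`. [this work] -/
theorem commonEQ_subset_commonLE (c : ℕ) (KX KZ : Finset (Finset α)) : commonEQ c KX KZ ⊆ commonLE c KX KZ := by
  intro S hS
  simp only [commonEQ, commonLE, mem_filter, mem_powerset, subset_univ, true_and] at hS ⊢
  exact ⟨hS.1.le, hS.2.1, hS.2.2⟩

/-- `h` of the peeled family: `h_X ∖ e_Y`. [this work] -/
theorem facesLE_peelX (c : ℕ) (KX KZ : Finset (Finset α)) : facesLE c (peelX c KX KZ) = facesLE c KX \ commonEQ c KX KZ := by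
  ext S; simp only [peelX, facesLE, mem_filter, mem_sdiff, mem_powerset, subset_univ, true_and]; tauto

/-- `t` of the peeled family is `t_X` (the removed faces have size `c`). [this work] -/
theorem facesGT_peelX (c : ℕ) (KX KZ : Finset (Finset α)) : facesGT c (peelX c KX KZ) = facesGT c KX := by
  ext S; simp only [peelX, facesGT, commonEQ, mem_filter, mem_sdiff, mem_powerset, subset_univ, true_and]
  constructor
  · rintro ⟨h1, h2, _⟩; exact ⟨h1, h2⟩
  · rintro ⟨h1, h2⟩; exact ⟨h1, h2, fun h => by omega⟩

/-- `h_Y` of the peeled pair: `h_Y ∖ e_Y`. [this work] -/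
theorem commonLE_peelX (c : ℕ) (KX KZ : Finset (Finset α)) :
    commonLE c (peelX c KX KZ) KZ = commonLE c KX KZ \ commonEQ c KX KZ := by
  ext S; simp only [peelX, commonLE, mem_filter, mem_sdiff, mem_powerset, subset_univ, true_and]; tauto

/-- The peeled pair shares no `c`-face. [this work] -/
theorem commonEQ_peelX (c : ℕ) (KX KZ : Finset (Finset α)) : commonEQ c (peelX c KX KZ) KZ = ∅ := by
  ext S; simp only [peelX, commonEQ, mem_filter, mem_sdiff, mem_powerset, subset_univ, true_and, notMem_empty, iff_false]
  rintro ⟨h1, ⟨h2, h3⟩, h4⟩; exact h3 ⟨h1, h2, h4⟩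

omit [Fintype α] in
/-- `GF(A) = GF(A ∖ B) + GF(B)` for `B ⊆ A`. [this work] -/
theorem gf_eq_sdiff_add {A B : Finset (Finset α)} (h : B ⊆ A) : gf A = gf (A \ B) + gf B := by
  rw [← gf_union disjoint_sdiff_self_left, sdiff_union_of_subset h]

/-! ### The peeling identity -/

/-- **PEELING IDENTITY: `Ñ_c(K_X,K_Z) = Ñ_c(K_X ∖ e_Y, K_Z) + GF(e_Y)·B_c(K_Z)`** (every `c`, every pair of families). [this work] -/
theorem Ngen_eq_peel (c : ℕ) (KX KZ : Finset (Finset α)) :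
    Ngen c KX KZ = Ngen c (peelX c KX KZ) KZ + gf (commonEQ c KX KZ) * peelB c KZ := by
  have h1 := gf_eq_sdiff_add (commonEQ_subset_facesLE c KX KZ)
  have h2 := gf_eq_sdiff_add (commonEQ_subset_commonLE c KX KZ)
  have h3 : gf (commonEQ c (peelX c KX KZ) KZ) = 0 := by rw [commonEQ_peelX]; unfold gf; simp
  unfold Ngen peelB
  rw [facesLE_peelX, facesGT_peelX, commonLE_peelX, h3, h1, h2]
  ring

/-! ### The peeled complex -/

/-- If `K_X` is a complex without faces above `c`, the peeled family is again a complex. [this work] -/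
theorem isLowerSet_peelX (c : ℕ) {KX KZ : Finset (Finset α)} (hKX : IsLowerSet (KX : Set (Finset α))) (hX : facesGT c KX = ∅) :
    IsLowerSet ((peelX c KX KZ : Finset (Finset α)) : Set (Finset α)) := by
  intro S T hTS hS
  rw [Finset.mem_coe] at hS ⊢
  simp only [peelX, mem_sdiff] at hS ⊢
  refine ⟨hKX hTS hS.1, fun hT => hS.2 ?_⟩
  have hSc : #S ≤ c := by
    by_contra hc
    have : S ∈ facesGT c KX := mem_filter.2 ⟨mem_powerset.2 (subset_univ _), by omega, hS.1⟩
    rw [hX] at this; simp at this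
  simp only [commonEQ, mem_filter, mem_powerset, subset_univ, true_and] at hT ⊢
  have hTS' : T = S := eq_of_subset_of_card_le hTS (by omega)
  subst hTS'
  exact ⟨hT.1, hS.1, hT.2.2⟩

/-- **The peeled pair has `Ñ_c ∈ ℕ[r]`** when `K_X` is a complex with `t_X = ∅` and `K_Z` a complex: by the level split, `T_c` is `e_c`
times a Harris block (`e_Y = ∅`) and `R_c` is `D_c` times a Harris block (`t_X = ∅`). [this work] -/
theorem coeff_Ngen_peel_nonneg (c : ℕ) {KX KZ : Finset (Finset α)} (hKX : IsLowerSet (KX : Set (Finset α)))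
    (hKZ : IsLowerSet (KZ : Set (Finset α))) (hX : facesGT c KX = ∅) : ∀ n, 0 ≤ (Ngen c (peelX c KX KZ) KZ).coeff n := by
  have hKX' := isLowerSet_peelX c (KZ := KZ) hKX hX
  have hX' : facesGT c (peelX c KX KZ) = ∅ := by rw [facesGT_peelX, hX]
  exact coeff_Ngen_nonneg_of_split (coeff_TcForm_nonneg_of_commonEQ_empty c hKX' hKZ (commonEQ_peelX c KX KZ))
    (coeff_RcForm_nonneg_of_facesGT_empty_left c hKX' hKZ hX')

/-! ### Value-level consequences -/

omit [DecidableEq α] [Fintype α] in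
/-- A polynomial with nonnegative integer coefficients is nonnegative at every nonnegative point. [this work] -/
theorem eval_nonneg_of_coeff_nonneg {P : MvPolynomial α ℤ} (hP : ∀ m, 0 ≤ P.coeff m) (r : α → ℝ) (hr : ∀ i, 0 ≤ r i) :
    0 ≤ eval₂ (Int.castRingHom ℝ) r P := by
  have h := eval_le_of_coeff_le (P := (0 : MvPolynomial α ℤ)) (Q := P) (fun m => by rw [coeff_zero]; exact hP m) r hr
  rwa [eval₂_zero] at h

/-- **PEELING AT THE VALUE LEVEL**: `K_X, K_Z` complexes, `K_X` without faces above `c`, `r ≥ 0` with `B_c(K_Z)(r) ≥ 0` ("`K_Z` light at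
`r`") ⇒ `Ñ_c(K_X,K_Z)(r) ≥ 0`. [this work] -/
theorem eval_Ngen_nonneg_of_peelB (c : ℕ) {KX KZ : Finset (Finset α)} (hKX : IsLowerSet (KX : Set (Finset α)))
    (hKZ : IsLowerSet (KZ : Set (Finset α))) (hX : facesGT c KX = ∅) (r : α → ℝ) (hr : ∀ i, 0 ≤ r i)
    (hB : 0 ≤ eval₂ (Int.castRingHom ℝ) r (peelB c KZ)) : 0 ≤ eval₂ (Int.castRingHom ℝ) r (Ngen c KX KZ) := by
  rw [Ngen_eq_peel, eval₂_add, eval₂_mul]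
  exact add_nonneg (eval_nonneg_of_coeff_nonneg (coeff_Ngen_peel_nonneg c hKX hKZ hX) r hr)
    (mul_nonneg (eval_nonneg_of_coeff_nonneg (coeff_gf_nonneg _) r hr) hB)

/-- The mirror image: `K_Z` without faces above `c` and `K_X` light at `r` ⇒ `Ñ_c(K_X,K_Z)(r) ≥ 0`. [this work] -/
theorem eval_Ngen_nonneg_of_peelB_right (c : ℕ) {KX KZ : Finset (Finset α)} (hKX : IsLowerSet (KX : Set (Finset α)))
    (hKZ : IsLowerSet (KZ : Set (Finset α))) (hZ : facesGT c KZ = ∅) (r : α → ℝ) (hr : ∀ i, 0 ≤ r i)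
    (hB : 0 ≤ eval₂ (Int.castRingHom ℝ) r (peelB c KX)) : 0 ≤ eval₂ (Int.castRingHom ℝ) r (Ngen c KX KZ) := by
  rw [Ngen_comm]; exact eval_Ngen_nonneg_of_peelB c hKZ hKX hZ r hr hB

/-- `Π − h_Z = GF(small non-faces) + D_c` when `K_Z` has no face above `c`. [this work] -/
theorem PiP_sub_facesLE_eq (c : ℕ) {KZ : Finset (Finset α)} (hZ : facesGT c KZ = ∅) :
    (PiP : MvPolynomial α ℤ) - gf (facesLE c KZ) = gf ((bySize (· ≤ c) : Finset (Finset α)) \ facesLE c KZ) + DdC c := by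
  have hsub : facesLE c KZ ⊆ (bySize (· ≤ c) : Finset (Finset α)) := by
    intro S hS
    simp only [facesLE, bySize, mem_filter, mem_powerset, subset_univ, true_and] at hS ⊢
    exact hS.1
  have hΘ : (ThC c : MvPolynomial α ℤ) = gf ((bySize (· ≤ c) : Finset (Finset α)) \ facesLE c KZ) + gf (facesLE c KZ) := by
    unfold ThC; exact gf_eq_sdiff_add hsub
  have _ := hZ
  rw [PiP_eq_ThC_add_DdC_gen (α := α) c, hΘ]
  ring

/-- **PARAMETER-ONLY COROLLARY**: `K_X, K_Z` complexes with no faces above `c`, and `r ≥ 0` with `(e_c·(Π + D_c) − Θ_c·Π)(r) ≥ 0`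
⇒ `Ñ_c(K_X,K_Z)(r) ≥ 0`.  (Dual reading at `c = k − 2`: both up-sets loop-free and `P(N=2)(1+P(N≤1)) ≥ P(N≥2)`.) [this work] -/
theorem eval_Ngen_nonneg_of_rowCap (c : ℕ) {KX KZ : Finset (Finset α)} (hKX : IsLowerSet (KX : Set (Finset α)))
    (hKZ : IsLowerSet (KZ : Set (Finset α))) (hX : facesGT c KX = ∅) (hZ : facesGT c KZ = ∅) (r : α → ℝ) (hr : ∀ i, 0 ≤ r i)
    (hA : 0 ≤ eval₂ (Int.castRingHom ℝ) r (ee c * (PiP + DdC c) - ThC c * PiP : MvPolynomial α ℤ)) :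
    0 ≤ eval₂ (Int.castRingHom ℝ) r (Ngen c KX KZ) := by
  refine eval_Ngen_nonneg_of_peelB c hKX hKZ hX r hr ?_
  obtain ⟨hPi, hec, hTh, hDd⟩ := coeff_PiP_ee_nonneg (α := α) c
  have htZ : gf (facesGT c KZ) = (0 : MvPolynomial α ℤ) := by rw [hZ]; unfold gf; simp
  set E : ℝ := eval₂ (Int.castRingHom ℝ) r (ee c : MvPolynomial α ℤ)
  set Pv : ℝ := eval₂ (Int.castRingHom ℝ) r (PiP : MvPolynomial α ℤ)
  set Dv : ℝ := eval₂ (Int.castRingHom ℝ) r (DdC c : MvPolynomial α ℤ)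
  set Tv : ℝ := eval₂ (Int.castRingHom ℝ) r (ThC c : MvPolynomial α ℤ)
  set Gv : ℝ := eval₂ (Int.castRingHom ℝ) r (gf ((bySize (· ≤ c) : Finset (Finset α)) \ facesLE c KZ))
  have hE : 0 ≤ E := eval_nonneg_of_coeff_nonneg hec r hr
  have hP : 0 ≤ Pv := eval_nonneg_of_coeff_nonneg hPi r hr
  have hD : 0 ≤ Dv := eval_nonneg_of_coeff_nonneg hDd r hr
  have hG : 0 ≤ Gv := eval_nonneg_of_coeff_nonneg (coeff_gf_nonneg _) r hr
  have hA' : 0 ≤ E * (Pv + Dv) - Tv * Pv := by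
    rw [eval₂_sub, eval₂_mul, eval₂_mul, eval₂_add] at hA; exact hA
  unfold peelB
  rw [htZ, mul_zero, sub_zero, eval₂_sub, eval₂_mul, eval₂_mul, eval₂_mul, eval₂_mul, eval₂_add, PiP_sub_facesLE_eq c hZ, eval₂_add]
  have key : E * (Pv + Dv) * (Gv + Dv) - Tv * Pv * Dv = E * (Pv + Dv) * Gv + Dv * (E * (Pv + Dv) - Tv * Pv) := by ring
  rw [key]
  exact add_nonneg (mul_nonneg (mul_nonneg hE (add_nonneg hP hD)) hG) (mul_nonneg hD hA')

end Summit.CriticalPhenomena.PercolationContinuityZ3.Theorems.SahiCTCForms
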